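import Summits.Ventures.HSemireg.WedgeHankelRecurrenceGaussSymmetricCommonZero

/-!
# Venture HSemireg — **THE RESULTANT OF `He_{n+2}` AND `He_n` OVER `ℤ`**: by N421 (`Res(q_{n+2}, q_n) = q_n(a_{n+1}) ∏(−b_k)^k`) and N427 (`He_{2m+1}(0) = 0`, `He_{2m}(0) = (−1)^m · 1·3⋯(2m−1)`):
# **`Res_{(2m+3,2m+1)}(He_{2m+3}, He_{2m+1}) = 0`** and **`Res_{(2m+2,2m)}(He_{2m+2}, He_{2m}) = (−1)^m (∏_{k<m} (2k+1)) · ∏_{k<2m} (−(k+1))^{k+1}`** (Mathlib's `Polynomial.hermite`, in `ℤ`)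

HONEST FRAMING. Part of the Lean index of the computation cell `pub-hsemireg` (seat p10 gen 47, Sunday typer «UNIFORM-IN-n»).  Integer polynomial algebra only (Mathlib `Polynomial.resultant`,
`Polynomial.hermite`); no variety, no cohomology theory, no sheaf, no Ext group and no semiregularity map is constructed here; nothing here says that HC / HC_CM / HC_AV holds; no Literature fact
(unproved `Prop`) is declared or used.  Custodian versions as in `WedgeHankelSiegelIdeal` (1/3).
SOURCES (cited).  I. Schur, J. reine angew. Math. 165 (1931) 52–58, §§1–2 (resultants in the Hermite ∕ Laguerre families); G. Szegő, *Orthogonal Polynomials*, (5.5.5) (`He_{2m}(0)`).  The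
displayed values are COROLLARIES typed here of N421 ∕ N427.
PROOF TYPED HERE.  N421 `resultant_gap_two` over `ℤ` with the three-term form N359 `hermite_three_term`; N427 `recurrence_eval_zero_of_diag_zero`.
DEDUP DISCLOSURE (`rg -n -i 'hermite_resultant' Summits/Ventures/HSemireg Literature`, 2026-09-04): nothing; 0 hits for the 3 names below.

WHAT IS IN THE TREE.  N421 `resultant_gap_two`; N427 `recurrence_eval_zero_of_diag_zero`; N403 `schur_resultant`; N359 `hermite_three_term`.
THIS FILE (namespace `Summit.Ventures.HSemireg.Wedge.HankelOuter` continued; CHAINED on N427 (import only); 0 definitions):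
* §1193 `hermite_resultant_succ` (`Res_{(n+1,n)}(He_{n+1}, He_n) = ∏_{k<n} (−(k+1))^{k+1}`), **`hermite_resultant_gap_two_odd`** (`= 0`), **`hermite_resultant_gap_two_even`**.
CAVEATS.  Formal degrees explicit.  Nothing Ext-side.  New names only.
-/

open Module Polynomial
open scoped Matrix Polynomial

namespace Summit.Ventures.HSemireg.Wedge.HankelOuter

/-! ## §1193. `Res(He_{n+2}, He_n)` -/

/-- **`Res_{(n+1,n)}(He_{n+1}, He_n) = ∏_{k<n} (−(k+1))^{k+1}`** in `ℤ`. [Schur 1931 §2; this file, §1193] -/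
theorem hermite_resultant_succ (n : ℕ) :
    (Polynomial.hermite (n + 1)).resultant (Polynomial.hermite n) (n + 1) n = ∏ k ∈ Finset.range n, (-((k : ℤ) + 1)) ^ (k + 1) :=
  schur_resultant (R := ℤ) (q := fun m => Polynomial.hermite m) (a := fun _ => 0) (b := fun k => (k : ℤ))
    (by simp only [Polynomial.hermite_zero, map_one]) (by simp only [Polynomial.hermite_one, C_0, sub_zero])
    (fun m => by simp only [hermite_three_term, C_0, sub_zero]; push_cast; rfl) n

/-- **ODD INDEX: `Res_{(2m+3,2m+1)}(He_{2m+3}, He_{2m+1}) = 0`** (`0` is a common zero). [corollary of N421 ∕ N427; this file, §1193] -/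
theorem hermite_resultant_gap_two_odd (m : ℕ) :
    (Polynomial.hermite (2 * m + 1 + 2)).resultant (Polynomial.hermite (2 * m + 1)) (2 * m + 1 + 2) (2 * m + 1) = 0 := by
  have h := resultant_gap_two (R := ℤ) (q := fun m => Polynomial.hermite m) (a := fun _ => 0) (b := fun k => (k : ℤ))
    (by simp only [Polynomial.hermite_zero, map_one]) (by simp only [Polynomial.hermite_one, C_0, sub_zero])
    (fun m => by simp only [hermite_three_term, C_0, sub_zero]; push_cast; rfl) (2 * m + 1)
  have h0 := (recurrence_eval_zero_of_diag_zero (R := ℤ) (q := fun m => Polynomial.hermite m) (a := fun _ => 0) (b := fun k => (k : ℤ))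
    (by simp only [Polynomial.hermite_zero, map_one]) (by simp only [Polynomial.hermite_one, C_0, sub_zero])
    (fun m => by simp only [hermite_three_term, C_0, sub_zero]; push_cast; rfl) (fun _ => rfl) m).1
  rw [h, h0, zero_mul]

/-- **EVEN INDEX: `Res_{(2m+2,2m)}(He_{2m+2}, He_{2m}) = (−1)^m (∏_{k<m} (2k+1)) · ∏_{k<2m} (−(k+1))^{k+1}`.** [corollary of N421 ∕ N427; Szegő (5.5.5); this file, §1193] -/
theorem hermite_resultant_gap_two_even (m : ℕ) :
    (Polynomial.hermite (2 * m + 2)).resultant (Polynomial.hermite (2 * m)) (2 * m + 2) (2 * m) =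
      (-1) ^ m * (∏ k ∈ Finset.range m, (2 * (k : ℤ) + 1)) * ∏ k ∈ Finset.range (2 * m), (-((k : ℤ) + 1)) ^ (k + 1) := by
  have h := resultant_gap_two (R := ℤ) (q := fun m => Polynomial.hermite m) (a := fun _ => 0) (b := fun k => (k : ℤ))
    (by simp only [Polynomial.hermite_zero, map_one]) (by simp only [Polynomial.hermite_one, C_0, sub_zero])
    (fun m => by simp only [hermite_three_term, C_0, sub_zero]; push_cast; rfl) (2 * m)
  have h0 := (recurrence_eval_zero_of_diag_zero (R := ℤ) (q := fun m => Polynomial.hermite m) (a := fun _ => 0) (b := fun k => (k : ℤ))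
    (by simp only [Polynomial.hermite_zero, map_one]) (by simp only [Polynomial.hermite_one, C_0, sub_zero])
    (fun m => by simp only [hermite_three_term, C_0, sub_zero]; push_cast; rfl) (fun _ => rfl) m).2
  rw [h, h0]
  push_cast
  ring

end Summit.Ventures.HSemireg.Wedge.HankelOuter
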